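import Literature.Analysis.FluidPDE.NSKatoToClayProofs
import Literature.Analysis.FluidPDE.TaoClassGlobal
import Literature.Analysis.FluidPDE.CheskidovShvydkoyRegularProofs
import Literature.Analysis.FluidPDE.GIPGlobalStabilityProofs
import HarnessLib

/-!
# A global Kato solution from an `H^∞` datum is a global classical bounded-energy solution (no Schwartz decay),
# and GLOBAL CLASSICAL REGULARITY IS OPEN IN `L³` AROUND EVERY GLOBAL `H^∞ ∩ L³` DATUM

Analysis/FluidPDE support file. The tree's `exists_isTaoSolutionOn_of_hasGlobalKatoSolution` /
`clay_solution_of_hasGlobalKatoSolution_holds` (`NSKatoToClayProofs`, `NSKatoToClayHolds`) and the openness corollary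
`exists_L3_ball_global_classical_of_hasGlobalKatoSolution` (Summits side, `SterileGlobalOpenL3`) ask the datum to be
RAPIDLY DECAYING (Fefferman's class (4)). Slices `u(t)`, `t > 0`, of a Navier–Stokes flow are generically NOT rapidly
decaying (Brandolese–Meyer: the pressure tail is `O(|x|⁻⁴)`), but they ARE `H^∞` (Tao's class:
`IsTaoSolutionOn.slice`). This file removes the decay hypothesis: the restart induction of
`exists_isTaoSolutionOn_of_hasGlobalKatoSolution` uses it only to know `∫ ‖Dⁿu₀‖² < ∞` for all `n`.

* `exists_isTaoSolutionOn_of_hasGlobalKatoSolution_of_sobolev` — Tao-class solutions of every length from a smooth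
  divergence-free `H^∞` datum with a global Kato solution (the tree's proof verbatim with the `H^∞` hypothesis in place of
  `HasRapidSpatialDecay`; Tao's local theorem is the tree theorem `tao2011_smooth_local_existence_holds`);
* **`exists_global_classical_of_hasGlobalKatoSolution_of_sobolev`** — hence a global classical solution
  (`IsClassicalNSSolutionOn (Ici 0) ν 0 u p`, `u 0 = u₀`, `HasBoundedEnergy u`) by `IsTaoSolutionOn.global_of_nat`;
* **`exists_L3_ball_global_classical_of_hasGlobalKatoSolution_of_sobolev`** — Gallagher–Iftimie–Planchon openness
  (`GIP2003_L3_stability_holds`) for `H^∞ ∩ L³` data: around every weakly divergence-free `u₀ ∈ L³` with a global Kato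
  solution (`ν = 1`) there is an `L³`-ball all of whose smooth divergence-free `H^∞ ∩ L³` members have GLOBAL classical
  bounded-energy solutions;
* `IsTaoSolutionOn.memLp_three_slice` and **`IsTaoSolutionOn.exists_L3_ball_global_classical_of_slice`** — the form used
  along trajectories: if a slice `u t` of a Tao-class solution has a global Kato continuation, global classical regularity
  is `L³`-open around that slice among `H^∞ ∩ L³` data.

References: P. G. Lemarié-Rieusset, *The Navier–Stokes Problem in the 21st Century* (2016), Prop. 12.3 (von Wahl) with
Thm. 7.2 [cite: LemarieRieusset2016, Prop. 12.3 (von Wahl) with Thm. 7.2, PDF pp. 147, 393]; I. Gallagher, D. Iftimie,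
F. Planchon, Ann. Inst. Fourier 53 (2003), Thm. 0.1 [cite: GallagherIftimiePlanchon2003, Thm. 0.1 (p. 1389)]; T. Kato,
Math. Z. 187 (1984), Thm. 4 [cite: Kato1984, Thm. 4].
-/

noncomputable section

open MeasureTheory Set Function Filter Topology
open scoped ENNReal NNReal ContDiff

namespace Literature.Analysis.FluidPDE

/-! ### Tao-class solutions of every length from a global Kato solution, `H^∞` datum -/

/-- **`C([0, T]; L³)` is a regularity class, `H^∞` form** (von Wahl; Lemarié-Rieusset 2016, Prop. 12.3 with Thm. 7.2).
Assume Tao's local existence theorem. Let `ν > 0`, `u₀` smooth, divergence free with `∫ ‖Dⁿu₀‖² < ∞` for all `n`, and let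
`u₀` have a global Kato solution. Then for every `T > 0` there is a Tao-class solution on `[0, T] × ℝ³` from `u₀`. (The
tree's `exists_isTaoSolutionOn_of_hasGlobalKatoSolution` verbatim, the decay hypothesis replaced by the `H^∞` bound it was
used for.) [cite: LemarieRieusset2016, Prop. 12.3 (von Wahl) with Thm. 7.2, PDF pp. 147, 393] -/
theorem exists_isTaoSolutionOn_of_hasGlobalKatoSolution_of_sobolev (hE : tao2011_smooth_local_existence)
    {ν : ℝ} (hν : 0 < ν) {u₀ : EuclideanSpace ℝ (Fin 3) → EuclideanSpace ℝ (Fin 3)}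
    (hsm : ContDiff ℝ ∞ u₀) (hdiv : VectorCalculus.IsDivFree u₀)
    (hHinf : ∀ n : ℕ, ∫⁻ x, ‖iteratedFDeriv ℝ n u₀ x‖ₑ ^ 2 < ⊤)
    (hK : HasGlobalKatoSolution ν u₀) {Tt : ℝ} (hTt : 0 < Tt) :
    ∃ (u : ℝ → EuclideanSpace ℝ (Fin 3) → EuclideanSpace ℝ (Fin 3))
      (p : ℝ → EuclideanSpace ℝ (Fin 3) → ℝ), IsTaoSolutionOn Tt ν u₀ u p := by
  obtain ⟨w, hwmild, hwc, hw0, hwm⟩ := hK.exists_restrict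
  obtain ⟨c, hc, hloc⟩ := IsTaoSolutionOn.of_tao hE
  obtain ⟨δ₀, hδ₀, hens⟩ := enstrophy_le_mul_exp_of_split hν
  set Tw : ℝ := Tt + 1 with hTw
  have hTtw : Tt < Tw := by rw [hTw]; linarith
  -- `L³` tails of `w` on `[0, Tw]`
  obtain ⟨lam, hlam⟩ := (hwc (Icc 0 Tw) Icc_subset_Ici_self).exists_forall_eLpNorm_indicator_le
    isCompact_Icc (by norm_num : (1 : ℝ≥0∞) ≤ 3) (by norm_num) hδ₀
  set M : ℝ := max (lam : ℝ) 1 with hM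
  have hMpos : 0 < M := lt_of_lt_of_le one_pos (le_max_right _ _)
  -- energy and enstrophy of the datum
  set e₀ : ℝ := 2 * VectorCalculus.kineticEnergy u₀ with he₀
  have he₀0 : 0 ≤ e₀ := mul_nonneg zero_le_two (kineticEnergy_nonneg _)
  have hfrob_le3 : ∀ v : EuclideanSpace ℝ (Fin 3) → EuclideanSpace ℝ (Fin 3),
      ∫⁻ x, ENNReal.ofReal (frobeniusNormSq (fderiv ℝ v x)) ≤
        3 * ∫⁻ x, ‖iteratedFDeriv ℝ 1 v x‖ₑ ^ 2 := by
    intro v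
    calc ∫⁻ x, ENNReal.ofReal (frobeniusNormSq (fderiv ℝ v x))
        ≤ ∫⁻ x, 3 * ‖iteratedFDeriv ℝ 1 v x‖ₑ ^ 2 := lintegral_mono fun x => by
          rw [← ofReal_norm, norm_iteratedFDeriv_one, ofReal_norm]
          exact ofReal_frobeniusNormSq_le_three_mul_enorm_sq _
      _ = 3 * ∫⁻ x, ‖iteratedFDeriv ℝ 1 v x‖ₑ ^ 2 := lintegral_const_mul' _ _ (by simp)
  have hG₀ : ∫⁻ x, ENNReal.ofReal (frobeniusNormSq (fderiv ℝ u₀ x)) < ⊤ :=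
    (hfrob_le3 u₀).trans_lt (ENNReal.mul_lt_top (by simp) (hHinf 1))
  set g₀ : ℝ := (∫⁻ x, ENNReal.ofReal (frobeniusNormSq (fderiv ℝ u₀ x))).toReal with hg₀
  have hg₀0 : 0 ≤ g₀ := ENNReal.toReal_nonneg
  have hg₀eq : ∫⁻ x, ENNReal.ofReal (frobeniusNormSq (fderiv ℝ u₀ x)) = ENNReal.ofReal g₀ := by
    rw [hg₀, ENNReal.ofReal_toReal hG₀.ne]
  set A : ℝ := e₀ + Real.exp (2 * M ^ 2 * Tw / ν) * g₀ with hA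
  have hA0 : 0 ≤ A := by positivity
  have hA1 : 0 ≤ A + 1 := by positivity
  set τ : ℝ := min 1 (c * ν ^ 3 / (A + 1) ^ 2) with hτ
  have hτpos : 0 < τ := lt_min one_pos (by positivity)
  have hτ1 : τ ≤ 1 := min_le_left _ _
  have hτc : (A + 1) ^ 2 * τ ≤ c * ν ^ 3 := by
    calc (A + 1) ^ 2 * τ ≤ (A + 1) ^ 2 * (c * ν ^ 3 / (A + 1) ^ 2) :=
          mul_le_mul_of_nonneg_left (min_le_right _ _) (sq_nonneg _)
      _ = c * ν ^ 3 := by field_simp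
  /- the uniform `H¹` bound for Tao-class solutions from `u₀` on `[0, F]`, `F ≤ Tw` -/
  have hkey : ∀ ⦃F : ℝ⦄ ⦃u : ℝ → EuclideanSpace ℝ (Fin 3) → EuclideanSpace ℝ (Fin 3)⦄
      ⦃p : ℝ → EuclideanSpace ℝ (Fin 3) → ℝ⦄, 0 < F → F ≤ Tw →
      IsTaoSolutionOn F ν u₀ u p → ∀ t ∈ Icc 0 F,
        (∫⁻ x, ‖u t x‖ₑ ^ 2) + (∫⁻ x, ENNReal.ofReal (frobeniusNormSq (fderiv ℝ (u t) x))) ≤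
          ENNReal.ofReal (A + 1) := by
    intro F u p hF hFw h t ht
    have hae : ∀ s ∈ Icc 0 F, u s =ᵐ[volume] w s :=
      h.ae_eq_of_kato_Icc hν hF (hwmild F) (hwc (Icc 0 F) Icc_subset_Ici_self) (hwm F)
    have htail : ∀ s ∈ Icc 0 F,
        eLpNorm ({x | lam ≤ ‖w s x‖₊}.indicator (w s)) 3 volume ≤ ENNReal.ofReal δ₀ :=
      fun s hs => hlam s ⟨hs.1, hs.2.trans hFw⟩
    have hens_t := h.enstrophy_le_of_tails hF hens hae htail t ht
    have hener := h.lintegral_enorm_sq_le hF hν.le ht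
    have hexp : Real.exp (2 * M ^ 2 * t / ν) ≤ Real.exp (2 * M ^ 2 * Tw / ν) := by
      refine Real.exp_le_exp.2 (div_le_div_of_nonneg_right ?_ hν.le)
      exact mul_le_mul_of_nonneg_left (ht.2.trans hFw) (by positivity)
    calc (∫⁻ x, ‖u t x‖ₑ ^ 2) + (∫⁻ x, ENNReal.ofReal (frobeniusNormSq (fderiv ℝ (u t) x)))
        ≤ ENNReal.ofReal e₀ + ENNReal.ofReal (Real.exp (2 * M ^ 2 * t / ν)) *
            ∫⁻ x, ENNReal.ofReal (frobeniusNormSq (fderiv ℝ u₀ x)) := add_le_add hener hens_t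
      _ ≤ ENNReal.ofReal e₀ + ENNReal.ofReal (Real.exp (2 * M ^ 2 * Tw / ν)) * ENNReal.ofReal g₀ := by
          rw [hg₀eq]; gcongr
      _ = ENNReal.ofReal A := by
          rw [hA, ← ENNReal.ofReal_mul (Real.exp_nonneg _), ← ENNReal.ofReal_add he₀0 (by positivity)]
      _ ≤ ENNReal.ofReal (A + 1) := ENNReal.ofReal_le_ofReal (by linarith)
  /- the restart step -/
  have hstep : ∀ ⦃F : ℝ⦄ ⦃u : ℝ → EuclideanSpace ℝ (Fin 3) → EuclideanSpace ℝ (Fin 3)⦄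
      ⦃p : ℝ → EuclideanSpace ℝ (Fin 3) → ℝ⦄, 0 < F → F ≤ Tt →
      IsTaoSolutionOn F ν u₀ u p →
      ∃ (F' : ℝ) (u' : ℝ → EuclideanSpace ℝ (Fin 3) → EuclideanSpace ℝ (Fin 3))
        (p' : ℝ → EuclideanSpace ℝ (Fin 3) → ℝ), F + τ / 2 ≤ F' ∧ F' ≤ F + τ ∧
        IsTaoSolutionOn F' ν u₀ u' p' := by
    intro F u p hF hFT h
    set t' : ℝ := max (F / 2) (F - τ / 4) with ht'
    have ht'0 : 0 ≤ t' := le_max_of_le_left (by linarith)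
    have ht'F : t' < F := max_lt (by linarith) (by linarith)
    have hFt' : F ≤ t' + τ := by linarith [le_max_right (F / 2) (F - τ / 4)]
    have ht'I : t' ∈ Icc 0 F := ⟨ht'0, ht'F.le⟩
    obtain ⟨hsm', hdiv', hH'⟩ := h.slice ht'I
    have hbound := hkey hF (hFT.trans hTtw.le) h t' ht'I
    obtain ⟨v, q, hv⟩ := hloc hν hτpos hsm' hdiv' hH' hA1 hbound hτc
    refine ⟨t' + τ, _, _, by linarith [le_max_right (F / 2) (F - τ / 4)], by linarith,
      h.glue hv hν hτpos ht'0 ht'F hFt'⟩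
  /- the first patch, from the `H^∞` datum -/
  have hbase : ∃ (F : ℝ) (u : ℝ → EuclideanSpace ℝ (Fin 3) → EuclideanSpace ℝ (Fin 3))
      (p : ℝ → EuclideanSpace ℝ (Fin 3) → ℝ),
      IsTaoSolutionOn F ν u₀ u p ∧ 0 < F ∧ F ≤ Tw := by
    have hdat0 : ∫⁻ x, ‖u₀ x‖ₑ ^ 2 < ⊤ := by
      refine lt_of_le_of_lt (le_of_eq (lintegral_congr fun x => ?_)) (hHinf 0)
      rw [← ofReal_norm, ← ofReal_norm, norm_iteratedFDeriv_zero]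
    set A₀ : ℝ := ((∫⁻ x, ‖u₀ x‖ₑ ^ 2) +
      ∫⁻ x, ENNReal.ofReal (frobeniusNormSq (fderiv ℝ u₀ x))).toReal with hA₀
    have hA₀0 : 0 ≤ A₀ := ENNReal.toReal_nonneg
    have hA₀eq : (∫⁻ x, ‖u₀ x‖ₑ ^ 2) + ∫⁻ x, ENNReal.ofReal (frobeniusNormSq (fderiv ℝ u₀ x))
        ≤ ENNReal.ofReal A₀ := by
      rw [hA₀, ENNReal.ofReal_toReal (ENNReal.add_ne_top.2 ⟨hdat0.ne, hG₀.ne⟩)]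
    set T₀ : ℝ := min 1 (c * ν ^ 3 / (A₀ ^ 2 + 1)) with hT₀
    have hT₀pos : 0 < T₀ := lt_min one_pos (by positivity)
    have hT₀c : A₀ ^ 2 * T₀ ≤ c * ν ^ 3 := by
      calc A₀ ^ 2 * T₀ ≤ A₀ ^ 2 * (c * ν ^ 3 / (A₀ ^ 2 + 1)) :=
            mul_le_mul_of_nonneg_left (min_le_right _ _) (sq_nonneg _)
        _ = c * ν ^ 3 * (A₀ ^ 2 / (A₀ ^ 2 + 1)) := by ring
        _ ≤ c * ν ^ 3 * 1 :=
            mul_le_mul_of_nonneg_left (by rw [div_le_one (by positivity)]; linarith) (by positivity)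
        _ = c * ν ^ 3 := mul_one _
    obtain ⟨u, p, h⟩ := hloc hν hT₀pos hsm hdiv hHinf hA₀0 hA₀eq hT₀c
    exact ⟨T₀, u, p, h, hT₀pos, (min_le_left _ _).trans (by rw [hTw]; linarith)⟩
  /- the induction -/
  have hiter : ∀ k : ℕ, ∃ (F : ℝ) (u : ℝ → EuclideanSpace ℝ (Fin 3) → EuclideanSpace ℝ (Fin 3))
      (p : ℝ → EuclideanSpace ℝ (Fin 3) → ℝ),
      IsTaoSolutionOn F ν u₀ u p ∧ 0 < F ∧ F ≤ Tw ∧ (Tt ≤ F ∨ (k : ℝ) * (τ / 2) ≤ F) := by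
    intro k
    induction k with
    | zero =>
      obtain ⟨F, u, p, h, hF, hFw⟩ := hbase
      exact ⟨F, u, p, h, hF, hFw, Or.inr (by simpa using hF.le)⟩
    | succ k ih =>
      obtain ⟨F, u, p, h, hF, hFw, halt⟩ := ih
      rcases le_or_gt Tt F with hdone | hlt
      · exact ⟨F, u, p, h, hF, hFw, Or.inl hdone⟩
      · obtain ⟨F', u', p', h1, h2, h'⟩ := hstep hF hlt.le h
        refine ⟨F', u', p', h', by linarith, ?_, ?_⟩
        · rw [hTw]; linarith
        · rcases halt with hd | hk
          · exact absurd hd (not_le.2 hlt)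
          · right
            push_cast
            linarith
  obtain ⟨k, hk⟩ := exists_nat_gt (Tw / (τ / 2))
  obtain ⟨F, u, p, h, hF, hFw, halt⟩ := hiter k
  have hTtF : Tt ≤ F := by
    rcases halt with hd | hk'
    · exact hd
    · exfalso
      have h2 : Tw < (k : ℝ) * (τ / 2) := by rwa [div_lt_iff₀ (by positivity)] at hk
      linarith
  exact ⟨u, p, h.mono hTt hTtF⟩

/-! ### The global classical solution -/

/-- **A GLOBAL KATO SOLUTION FROM A SMOOTH DIVERGENCE-FREE `H^∞` DATUM IS A GLOBAL CLASSICAL BOUNDED-ENERGY SOLUTION**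
(no spatial decay beyond `H^∞` asked): Tao-class solutions of every integer length
(`exists_isTaoSolutionOn_of_hasGlobalKatoSolution_of_sobolev` with the tree theorem `tao2011_smooth_local_existence_holds`)
patched by `IsTaoSolutionOn.global_of_nat`. [cite: LemarieRieusset2016, Prop. 12.3 (von Wahl) with Thm. 7.2, PDF pp. 147, 393] -/
theorem exists_global_classical_of_hasGlobalKatoSolution_of_sobolev
    {ν : ℝ} (hν : 0 < ν) {u₀ : EuclideanSpace ℝ (Fin 3) → EuclideanSpace ℝ (Fin 3)}
    (hsm : ContDiff ℝ ∞ u₀) (hdiv : VectorCalculus.IsDivFree u₀)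
    (hHinf : ∀ n : ℕ, ∫⁻ x, ‖iteratedFDeriv ℝ n u₀ x‖ₑ ^ 2 < ⊤) (hK : HasGlobalKatoSolution ν u₀) :
    ∃ (u : ℝ → EuclideanSpace ℝ (Fin 3) → EuclideanSpace ℝ (Fin 3)) (p : ℝ → EuclideanSpace ℝ (Fin 3) → ℝ),
      IsClassicalNSSolutionOn (Ici 0) ν 0 u p ∧ u 0 = u₀ ∧ HasBoundedEnergy u := by
  have hex : ∀ n : ℕ, ∃ (u : ℝ → EuclideanSpace ℝ (Fin 3) → EuclideanSpace ℝ (Fin 3))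
      (p : ℝ → EuclideanSpace ℝ (Fin 3) → ℝ), IsTaoSolutionOn ((n : ℝ) + 1) ν u₀ u p := fun n =>
    exists_isTaoSolutionOn_of_hasGlobalKatoSolution_of_sobolev tao2011_smooth_local_existence_holds hν hsm hdiv hHinf hK
      (by positivity)
  choose U P hUP using hex
  obtain ⟨hcl, h0, hEn⟩ := IsTaoSolutionOn.global_of_nat hUP hν
  exact ⟨_, _, hcl, h0, hEn⟩

/-! ### Openness of global classical regularity in `L³` for `H^∞ ∩ L³` data -/

/-- **GLOBAL CLASSICAL REGULARITY IS OPEN IN `L³` AROUND EVERY GLOBAL KATO DATUM, `H^∞ ∩ L³` form** (GIP 2003 Thm 0.1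
= tree `GIP2003_L3_stability_holds`, plus the previous theorem): for weakly divergence-free `u₀ ∈ L³` with a global Kato
solution at unit viscosity there is `ε > 0` such that EVERY smooth divergence-free `a` with `∫ ‖Dⁿa‖² < ∞` for all `n`,
`a ∈ L³` and `‖a − u₀‖_{L³} < ε` has a global classical bounded-energy solution of the unforced unit-viscosity system.
[cite: GallagherIftimiePlanchon2003, Thm. 0.1 (p. 1389)] -/
theorem exists_L3_ball_global_classical_of_hasGlobalKatoSolution_of_sobolev
    {u₀ : EuclideanSpace ℝ (Fin 3) → EuclideanSpace ℝ (Fin 3)}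
    (hu3 : MemLp u₀ 3 volume) (hwdiv : IsWeaklyDivFree u₀) (hK : HasGlobalKatoSolution 1 u₀) :
    ∃ ε : ℝ, 0 < ε ∧
      ∀ a : EuclideanSpace ℝ (Fin 3) → EuclideanSpace ℝ (Fin 3),
        ContDiff ℝ ∞ a → VectorCalculus.IsDivFree a → (∀ n : ℕ, ∫⁻ x, ‖iteratedFDeriv ℝ n a x‖ₑ ^ 2 < ⊤) →
        MemLp a 3 volume → eLpNorm (a - u₀) 3 volume < ENNReal.ofReal ε →
        ∃ (U : ℝ → EuclideanSpace ℝ (Fin 3) → EuclideanSpace ℝ (Fin 3))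
          (P : ℝ → EuclideanSpace ℝ (Fin 3) → ℝ),
          IsClassicalNSSolutionOn (Ici 0) 1 0 U P ∧ U 0 = a ∧ HasBoundedEnergy U := by
  obtain ⟨ε, hε, hball⟩ :=
    GIP2003_L3_stability.exists_ball_hasGlobalKatoSolution_one GIP2003_L3_stability_holds hu3 hwdiv hK
  refine ⟨ε, hε, fun a ha hadiv haH ha3 hlt => ?_⟩
  have hawdiv : IsWeaklyDivFree a :=
    VectorCalculus.IsDivFree.isWeaklyDivFree_holds hadiv (ha.of_le (mod_cast le_top))
  have hlt' : eLpNorm (u₀ - a) 3 volume < ENNReal.ofReal ε := by rwa [eLpNorm_sub_comm]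
  exact exists_global_classical_of_hasGlobalKatoSolution_of_sobolev one_pos ha hadiv haH (hball a ha3 hawdiv hlt')

/-! ### Along trajectories: slices of Tao-class solutions -/

namespace IsTaoSolutionOn

variable {T ν : ℝ} {u₀ : EuclideanSpace ℝ (Fin 3) → EuclideanSpace ℝ (Fin 3)}
  {u : ℝ → EuclideanSpace ℝ (Fin 3) → EuclideanSpace ℝ (Fin 3)} {p : ℝ → EuclideanSpace ℝ (Fin 3) → ℝ}

/-- **Every slice of a Tao-class solution is in `L³`** (`L² ∩ L^∞ ⊂ L³`: `‖v‖₃³ ≤ ‖v‖_∞ ‖v‖₂²`, the slice is bounded by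
`exists_bound_velocity` and square integrable by `sobolev 0`). [cite: LemarieRieusset2016, Prop. 12.3 (von Wahl) with Thm. 7.2, PDF pp. 147, 393] -/
theorem memLp_three_slice (h : IsTaoSolutionOn T ν u₀ u p) {t : ℝ} (ht : t ∈ Icc 0 T) : MemLp (u t) 3 volume := by
  obtain ⟨hsm, -, hH⟩ := h.slice ht
  have hmeas : AEStronglyMeasurable (u t) volume := hsm.continuous.aestronglyMeasurable
  have hL2 : ∫⁻ x, ‖u t x‖ₑ ^ 2 < ⊤ := by
    refine lt_of_le_of_lt (le_of_eq (lintegral_congr fun x => ?_)) (hH 0)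
    rw [← ofReal_norm, ← ofReal_norm, norm_iteratedFDeriv_zero]
  have hu2 : MemLp (u t) 2 volume := ⟨hmeas, eLpNorm_two_lt_top_of_lintegral_enorm_sq_lt_top hL2⟩
  obtain ⟨B, -, hB⟩ := h.exists_bound_velocity
  refine ⟨hmeas, ?_⟩
  have h3 : eLpNorm (u t) 3 volume ^ 3 ≤ eLpNorm (u t) ⊤ volume * eLpNorm (u t) 2 volume ^ 2 :=
    eLpNorm_three_pow_le hmeas
  have htop : eLpNorm (u t) ⊤ volume ≤ ENNReal.ofReal B := eLpNorm_top_le_of_bound (hB t ht)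
  have hfin : eLpNorm (u t) ⊤ volume * eLpNorm (u t) 2 volume ^ 2 < ⊤ :=
    ENNReal.mul_lt_top (htop.trans_lt ENNReal.ofReal_lt_top) (ENNReal.pow_lt_top hu2.eLpNorm_lt_top)
  by_contra hnot
  rw [not_lt, top_le_iff] at hnot
  rw [hnot, ENNReal.top_pow (by norm_num)] at h3
  exact absurd (h3.trans_lt hfin) (lt_irrefl _)

/-- **GLOBAL CLASSICAL REGULARITY IS `L³`-OPEN AROUND ANY SLICE OF A TAO-CLASS SOLUTION THAT HAS A GLOBAL KATO CONTINUATION**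
(unit viscosity): if `h : IsTaoSolutionOn T 1 u₀ u p`, `t ∈ [0, T]` and `u t` has a global Kato solution, then there is
`ε > 0` such that every smooth divergence-free `H^∞ ∩ L³` datum `a` with `‖a − u t‖_{L³} < ε` has a global classical
bounded-energy solution. (The slice is `H^∞`, weakly divergence free and in `L³`; then the previous theorem.)
[cite: GallagherIftimiePlanchon2003, Thm. 0.1 (p. 1389)] -/
theorem exists_L3_ball_global_classical_of_slice (h : IsTaoSolutionOn T 1 u₀ u p) {t : ℝ} (ht : t ∈ Icc 0 T)
    (hK : HasGlobalKatoSolution 1 (u t)) :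
    ∃ ε : ℝ, 0 < ε ∧
      ∀ a : EuclideanSpace ℝ (Fin 3) → EuclideanSpace ℝ (Fin 3),
        ContDiff ℝ ∞ a → VectorCalculus.IsDivFree a → (∀ n : ℕ, ∫⁻ x, ‖iteratedFDeriv ℝ n a x‖ₑ ^ 2 < ⊤) →
        MemLp a 3 volume → eLpNorm (a - u t) 3 volume < ENNReal.ofReal ε →
        ∃ (U : ℝ → EuclideanSpace ℝ (Fin 3) → EuclideanSpace ℝ (Fin 3))
          (P : ℝ → EuclideanSpace ℝ (Fin 3) → ℝ),
          IsClassicalNSSolutionOn (Ici 0) 1 0 U P ∧ U 0 = a ∧ HasBoundedEnergy U := by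
  obtain ⟨hsm, hdiv, -⟩ := h.slice ht
  have hwdiv : IsWeaklyDivFree (u t) :=
    VectorCalculus.IsDivFree.isWeaklyDivFree_holds hdiv (hsm.of_le (mod_cast le_top))
  exact exists_L3_ball_global_classical_of_hasGlobalKatoSolution_of_sobolev (h.memLp_three_slice ht) hwdiv hK

end IsTaoSolutionOn

end Literature.Analysis.FluidPDE

end
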